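import Summits.CriticalPhenomena.CardyFormulaZ2.Theorems.CardyFlipRussoVoronoiHubFromSmirnovOneArmEvents
import Summits.CriticalPhenomena.CardyFormulaZ2.Theorems.CardyFlipRussoVoronoiHubFromSmirnovDelaunayLocal
import Summits.CriticalPhenomena.CardyFormulaZ2.Theorems.CardyFlipRussoVoronoiHubFromSmirnovCellNoVoid

/-!
# Defect pairs force potential defects, locally and in configuration coordinates (one-arm route, Pr1a)

Line `moebius-exact-delaunay-dilation-ward` of crux `VoronoiHubFromSmirnov` (stmt-CriticalPhenomena-6433),
lead c3.  Benjamini–Schramm's Lemma 4.2 is landed as `defect_implies_potentialDefect`: for a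
`C^{1,1}`-conformal map on a convex set `B` containing ALL sites, a Delaunay pair whose image is not
Delaunay sits at a near-tied navel or a close pair.  The one-arm route needs it SQUARE BY SQUARE for
the windowed nuclei `N` (configuration coordinates, mesh `δ`) and the transport map
`T = transportMap f δ` (`T b = f(δ b)/δ`), in both directions (Euclidean-but-not-pulled-back and
pulled-back-but-not-Euclidean adjacency), with constants UNIFORM in the position.  This file does the
plumbing:

* `concl_of_defectPackage` — the conclusion of Lemma 4.2 for the physical sites `δ • M` of a FINITE
  local configuration `M`, from the ∀-clause of `defect_implies_potentialDefect` for `(f, B)` (the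
  "package", obtained once per ball of a finite cover), the smallness of the cell of `p` in `M`, and
  a defect of the pair `(p, q)` between `M` and `T '' M` (scaling `y ↦ δ y` is a similarity);
* `nearTie_or_closePair_of_concl` — that conclusion, read back in configuration coordinates, is
  `NearTie M p ℓ ℓ (W δ² ℓ³) ∨ ClosePair M p (3ℓ) (W δ² ℓ³)` (events of the fourth definitions
  module);
* `potDef_of_euc_not_pull`, `potDef_of_pull_not_euc` — the two directions for the FULL windowed
  configuration `N ⊇ M = N ∩ closedBall p s`: localisation is legitimate on the no-void event by the
  landed `isDelaunayPair_of_local` (empty circumdiscs are small where there are no voids, so far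
  sites do not matter), on the domain side and on the image side respectively.
-/

noncomputable section

namespace Summit.CriticalPhenomena.CardyFormulaZ2.Cruxes.VoronoiHubFromSmirnov.MoebiusExactDelaunayDilationWard

open Set Metric
open Literature.Probability.LatticeModels (IsDelaunayPair voronoiCell)

/-! ### Scaling by the mesh -/

/-- Multiplication by a positive real scales distances. -/
theorem dist_real_mul (δ : ℝ) (hδ : 0 < δ) (x y : ℂ) :
    dist ((δ : ℂ) * x) ((δ : ℂ) * y) = δ * dist x y := by
  rw [dist_eq_norm, ← mul_sub, norm_mul, Complex.norm_real, Real.norm_eq_abs, abs_of_pos hδ,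
    dist_eq_norm]

/-- Delaunay adjacency is invariant under scaling by the mesh (a similarity). -/
theorem isDelaunayPair_image_mul_iff' : ∀ (δ : ℝ), 0 < δ → ∀ (M : Set ℂ) (p q : ℂ), Literature.Probability.LatticeModels.IsDelaunayPair ((fun y : ℂ => (δ : ℂ) * y) '' M) ((δ : ℂ) * p) ((δ : ℂ) * q) ↔ Literature.Probability.LatticeModels.IsDelaunayPair M p q :=
  fun δ hδ M p q =>
  Literature.Probability.LatticeModels.isDelaunayPair_image_iff (f := fun y : ℂ => (δ : ℂ) * y) hδ
    (dist_real_mul δ hδ) fun w => ⟨w / (δ : ℂ), by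
      simp only [mul_div_cancel₀ _ (Complex.ofReal_ne_zero.2 hδ.ne')]⟩

/-- Delaunay adjacency is invariant under scaling by the mesh (implicit-mesh form). -/
theorem isDelaunayPair_image_mul_iff {δ : ℝ} (hδ : 0 < δ) (M : Set ℂ) (p q : ℂ) :
    IsDelaunayPair ((fun y : ℂ => (δ : ℂ) * y) '' M) ((δ : ℂ) * p) ((δ : ℂ) * q) ↔
      IsDelaunayPair M p q :=
  isDelaunayPair_image_mul_iff' δ hδ M p q

/-- A small Voronoi cell stays small after scaling by the mesh. -/
theorem voronoiCell_image_mul_subset {δ ℓ : ℝ} (hδ : 0 < δ) {M : Set ℂ} {p : ℂ}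
    (h : voronoiCell M p ⊆ closedBall p ℓ) :
    voronoiCell ((fun y : ℂ => (δ : ℂ) * y) '' M) ((δ : ℂ) * p) ⊆ closedBall ((δ : ℂ) * p) (δ * ℓ) := by
  intro x hx
  have hδ' : (δ : ℂ) ≠ 0 := Complex.ofReal_ne_zero.2 hδ.ne'
  set x₀ : ℂ := x / (δ : ℂ) with hx₀
  have hxx : x = (δ : ℂ) * x₀ := by rw [hx₀, mul_div_cancel₀ _ hδ']
  have hcell : x₀ ∈ voronoiCell M p := by
    intro q hq
    have := hx ((δ : ℂ) * q) ⟨q, hq, rfl⟩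
    rw [hxx, dist_real_mul δ hδ, dist_real_mul δ hδ] at this
    exact le_of_mul_le_mul_left this hδ
  have := h hcell
  rw [mem_closedBall] at this ⊢
  rw [hxx, dist_real_mul δ hδ]
  exact mul_le_mul_of_nonneg_left this hδ.le

/-- The physical image of the physical sites is the mesh-scaling of the transported sites:
`f (δ y) = δ · transportMap f δ y`. -/
theorem image_f_image_mul_eq {δ : ℝ} (hδ : 0 < δ) (f : ℂ → ℂ) (M : Set ℂ) :
    f '' ((fun y : ℂ => (δ : ℂ) * y) '' M) =
      (fun y : ℂ => (δ : ℂ) * y) '' (transportMap f δ '' M) := by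
  have hδ' : (δ : ℂ) ≠ 0 := Complex.ofReal_ne_zero.2 hδ.ne'
  ext w
  simp only [mem_image, exists_exists_and_eq_and, transportMap, mul_div_cancel₀ _ hδ']

/-- Pointwise form of the previous identity. -/
theorem f_mul_eq {δ : ℝ} (hδ : 0 < δ) (f : ℂ → ℂ) (y : ℂ) :
    f ((δ : ℂ) * y) = (δ : ℂ) * transportMap f δ y := by
  have hδ' : (δ : ℂ) ≠ 0 := Complex.ofReal_ne_zero.2 hδ.ne'
  rw [transportMap, mul_div_cancel₀ _ hδ']

/-! ### The conclusion of Lemma 4.2 for a scaled finite configuration -/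

/-- **Lemma 4.2 for the physical sites of a finite local configuration.**  `hD` is the ∀-clause of
`defect_implies_potentialDefect` for the map `f` on the convex set `B` with constants `W, ℓ₀`.  For a
finite configuration `M` (configuration coordinates) whose physical sites `δ • M` lie in `B`,
distinct `p, q ∈ M` with a small cell at `p`, a Delaunay pair of `M` whose transported images are NOT
a Delaunay pair of the transported configuration, the potential-defect alternative holds for the
physical sites `δ • M`, `δ p`, `δ q` at physical scale `δ ℓ`. -/
theorem concl_of_defectPackage (f : ℂ → ℂ) (B : Set ℂ) (W ℓ₀ : ℝ)
    (hD : ∀ (ω : Set ℂ) (p q : ℂ) (ℓ : ℝ), ω ⊆ B → (∀ K : Set ℂ, IsCompact K → (ω ∩ K).Finite) →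
      p ∈ ω → q ∈ ω → p ≠ q → 0 < ℓ → ℓ ≤ ℓ₀ → closedBall p (4 * ℓ) ⊆ B →
      voronoiCell ω p ⊆ closedBall p ℓ → IsDelaunayPair ω p q →
      ¬ IsDelaunayPair (f '' ω) (f p) (f q) →
      (∃ (x a b : ℂ), a ∈ ω ∧ b ∈ ω ∧ a ≠ b ∧ a ≠ p ∧ a ≠ q ∧ b ≠ p ∧ b ≠ q ∧
        dist p x = dist q x ∧ dist p x ≤ ℓ ∧ (∀ d ∈ ω, dist p x ≤ dist d x) ∧
        dist a x = dist b x ∧ dist a x < dist p x + W * ℓ ^ 3) ∨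
      (∃ a ∈ ω, a ≠ p ∧ a ≠ q ∧ (dist a p < W * ℓ ^ 3 ∨ dist a q < W * ℓ ^ 3)))
    {δ ℓ : ℝ} (hδ : 0 < δ) (hℓ : 0 < ℓ) (hℓ₀ : δ * ℓ ≤ ℓ₀) {M : Set ℂ} (hM : M.Finite)
    (hMB : (fun y : ℂ => (δ : ℂ) * y) '' M ⊆ B) {p q : ℂ} (hp : p ∈ M) (hq : q ∈ M) (hpq : p ≠ q)
    (hball : closedBall ((δ : ℂ) * p) (4 * (δ * ℓ)) ⊆ B)
    (hcell : voronoiCell M p ⊆ closedBall p ℓ) (hE₁ : IsDelaunayPair M p q)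
    (hE₂ : ¬ IsDelaunayPair (transportMap f δ '' M) (transportMap f δ p) (transportMap f δ q)) :
    (∃ (x a b : ℂ), a ∈ (fun y : ℂ => (δ : ℂ) * y) '' M ∧ b ∈ (fun y : ℂ => (δ : ℂ) * y) '' M ∧
        a ≠ b ∧ a ≠ (δ : ℂ) * p ∧ a ≠ (δ : ℂ) * q ∧ b ≠ (δ : ℂ) * p ∧ b ≠ (δ : ℂ) * q ∧
        dist ((δ : ℂ) * p) x = dist ((δ : ℂ) * q) x ∧ dist ((δ : ℂ) * p) x ≤ δ * ℓ ∧
        (∀ d ∈ (fun y : ℂ => (δ : ℂ) * y) '' M, dist ((δ : ℂ) * p) x ≤ dist d x) ∧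
        dist a x = dist b x ∧ dist a x < dist ((δ : ℂ) * p) x + W * (δ * ℓ) ^ 3) ∨
      (∃ a ∈ (fun y : ℂ => (δ : ℂ) * y) '' M, a ≠ (δ : ℂ) * p ∧ a ≠ (δ : ℂ) * q ∧
        (dist a ((δ : ℂ) * p) < W * (δ * ℓ) ^ 3 ∨ dist a ((δ : ℂ) * q) < W * (δ * ℓ) ^ 3)) := by
  have hδ' : (δ : ℂ) ≠ 0 := Complex.ofReal_ne_zero.2 hδ.ne'
  refine hD _ _ _ (δ * ℓ) hMB (fun K _ => (hM.image _).subset inter_subset_left)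
    (mem_image_of_mem _ hp) (mem_image_of_mem _ hq) ?_ (mul_pos hδ hℓ) hℓ₀ hball
    (voronoiCell_image_mul_subset hδ hcell) ((isDelaunayPair_image_mul_iff hδ M p q).2 hE₁) ?_
  · intro h
    exact hpq (mul_left_cancel₀ hδ' h)
  · rw [image_f_image_mul_eq hδ, f_mul_eq hδ f p, f_mul_eq hδ f q, isDelaunayPair_image_mul_iff hδ]
    exact hE₂

/-- **Reading the conclusion in configuration coordinates.**  The potential-defect alternative for the
physical sites `δ • M` at `δ p`, `δ q`, physical scale `δ ℓ` and tolerance `W (δ ℓ)³`, is — after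
division by `δ` — a near-tied navel of `M` within `ℓ` of `p` or a close pair of `M` within `3ℓ` of `p`,
both with tolerance `W δ² ℓ³` (given `dist q p ≤ 2ℓ` and `W δ² ℓ³ ≤ ℓ` to place the close pair). -/
theorem nearTie_or_closePair_of_concl {δ ℓ W : ℝ} (hδ : 0 < δ) {M : Set ℂ} {p q : ℂ}
    (hp : p ∈ M) (hq : q ∈ M) (hpq : p ≠ q) (hqp : dist q p ≤ 2 * ℓ) (hτ : W * δ ^ 2 * ℓ ^ 3 ≤ ℓ)
    (h : (∃ (x a b : ℂ), a ∈ (fun y : ℂ => (δ : ℂ) * y) '' M ∧ b ∈ (fun y : ℂ => (δ : ℂ) * y) '' M ∧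
        a ≠ b ∧ a ≠ (δ : ℂ) * p ∧ a ≠ (δ : ℂ) * q ∧ b ≠ (δ : ℂ) * p ∧ b ≠ (δ : ℂ) * q ∧
        dist ((δ : ℂ) * p) x = dist ((δ : ℂ) * q) x ∧ dist ((δ : ℂ) * p) x ≤ δ * ℓ ∧
        (∀ d ∈ (fun y : ℂ => (δ : ℂ) * y) '' M, dist ((δ : ℂ) * p) x ≤ dist d x) ∧
        dist a x = dist b x ∧ dist a x < dist ((δ : ℂ) * p) x + W * (δ * ℓ) ^ 3) ∨
      (∃ a ∈ (fun y : ℂ => (δ : ℂ) * y) '' M, a ≠ (δ : ℂ) * p ∧ a ≠ (δ : ℂ) * q ∧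
        (dist a ((δ : ℂ) * p) < W * (δ * ℓ) ^ 3 ∨ dist a ((δ : ℂ) * q) < W * (δ * ℓ) ^ 3))) :
    NearTie M p ℓ ℓ (W * δ ^ 2 * ℓ ^ 3) ∨ ClosePair M p (3 * ℓ) (W * δ ^ 2 * ℓ ^ 3) := by
  have hδ' : (δ : ℂ) ≠ 0 := Complex.ofReal_ne_zero.2 hδ.ne'
  have hτδ : W * (δ * ℓ) ^ 3 = δ * (W * δ ^ 2 * ℓ ^ 3) := by ring
  rcases h with ⟨x, a, b, ⟨a', ha', rfl⟩, ⟨b', hb', rfl⟩, hab, hap, haq, hbp, hbq, hpx, hpxℓ, hmin,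
      habx, htie⟩ | ⟨a, ⟨a', ha', rfl⟩, hap, haq, hclose⟩
  · left
    set x' : ℂ := x / (δ : ℂ) with hx'
    have hxx : x = (δ : ℂ) * x' := by rw [hx', mul_div_cancel₀ _ hδ']
    rw [hxx] at hpx hpxℓ hmin habx htie
    simp only [dist_real_mul δ hδ] at hpx hpxℓ habx htie
    refine ⟨x', p, q, a', b', hp, hq, ha', hb', hpq, ?_, ?_, ?_, ?_, ?_, ?_, ?_, ?_, ?_, ?_, ?_⟩
    · exact fun h => hab (by rw [h])
    · exact fun h => hap (by rw [h])
    · exact fun h => haq (by rw [h])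
    · exact fun h => hbp (by rw [h])
    · exact fun h => hbq (by rw [h])
    · rw [mem_closedBall, dist_comm]; exact le_of_mul_le_mul_left hpxℓ hδ
    · exact mul_left_cancel₀ hδ.ne' hpx
    · exact le_of_mul_le_mul_left hpxℓ hδ
    · exact mul_left_cancel₀ hδ.ne' habx
    · have := hmin ((δ : ℂ) * a') ⟨a', ha', rfl⟩
      rw [dist_real_mul δ hδ, dist_real_mul δ hδ] at this
      exact le_of_mul_le_mul_left this hδ
    · rw [hτδ, ← mul_add] at htie
      exact lt_of_mul_lt_mul_left htie hδ.le
  · right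
    simp only [dist_real_mul δ hδ, hτδ] at hclose
    have hap' : a' ≠ p := fun h => hap (by rw [h])
    have haq' : a' ≠ q := fun h => haq (by rw [h])
    have hτ0 : dist a' p < W * δ ^ 2 * ℓ ^ 3 ∨ dist a' q < W * δ ^ 2 * ℓ ^ 3 := by
      rcases hclose with h | h
      · exact Or.inl (lt_of_mul_lt_mul_left h hδ.le)
      · exact Or.inr (lt_of_mul_lt_mul_left h hδ.le)
    rcases hτ0 with h | h
    · refine ⟨a', ha', p, hp, hap', ?_, h⟩
      rw [mem_closedBall]
      have : dist a' p ≤ ℓ := (h.le.trans hτ)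
      have hℓ0 : 0 ≤ ℓ := dist_nonneg.trans this
      linarith
    · refine ⟨a', ha', q, hq, haq', ?_, h⟩
      rw [mem_closedBall]
      have h1 : dist a' q ≤ ℓ := h.le.trans hτ
      linarith [dist_triangle a' q p]

/-! ### The two directions for the full windowed configuration -/

/-- **Direction 1: Euclidean-adjacent but not pulled-back-adjacent.**  Windowed nuclei `N`
(configuration coordinates), distinct `p, q ∈ N`, Delaunay-adjacent in `N` while their transported
images are not Delaunay-adjacent in `T '' N` (`T = transportMap f δ`).  Localise to
`M = N ∩ closedBall p s`: the pair stays Delaunay in `M` (fewer sites), and stays NON-Delaunay on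
the image side by `isDelaunayPair_of_local` (no void of radius `t'` near `T p` among images of
`M`-sites; images of the other sites farther than `2t'`); the cell of `p` in `M` is small by the
no-void hypothesis near `p`; then Lemma 4.2 (the package `hD` for `(f, B)`) applies to the finite
physical configuration `δ • M ⊆ B` and reads back as a near-tied navel or a close pair of `N` near
`p` with tolerance `W δ² ℓ³`. -/
theorem potDef_of_euc_not_pull (f : ℂ → ℂ) (B : Set ℂ) (W ℓ₀ : ℝ)
    (hD : ∀ (ω : Set ℂ) (p q : ℂ) (ℓ : ℝ), ω ⊆ B → (∀ K : Set ℂ, IsCompact K → (ω ∩ K).Finite) →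
      p ∈ ω → q ∈ ω → p ≠ q → 0 < ℓ → ℓ ≤ ℓ₀ → closedBall p (4 * ℓ) ⊆ B →
      voronoiCell ω p ⊆ closedBall p ℓ → IsDelaunayPair ω p q →
      ¬ IsDelaunayPair (f '' ω) (f p) (f q) →
      (∃ (x a b : ℂ), a ∈ ω ∧ b ∈ ω ∧ a ≠ b ∧ a ≠ p ∧ a ≠ q ∧ b ≠ p ∧ b ≠ q ∧
        dist p x = dist q x ∧ dist p x ≤ ℓ ∧ (∀ d ∈ ω, dist p x ≤ dist d x) ∧
        dist a x = dist b x ∧ dist a x < dist p x + W * ℓ ^ 3) ∨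
      (∃ a ∈ ω, a ≠ p ∧ a ≠ q ∧ (dist a p < W * ℓ ^ 3 ∨ dist a q < W * ℓ ^ 3)))
    {δ ℓ s t' : ℝ} (hδ : 0 < δ) (hℓ : 0 < ℓ) (ht' : 0 < t') (hℓs : 3 * ℓ ≤ s) (hℓ₀ : δ * ℓ ≤ ℓ₀)
    (hτ : W * δ ^ 2 * ℓ ^ 3 ≤ ℓ) {N : Set ℂ} {p q : ℂ} (hp : p ∈ N) (hq : q ∈ N) (hpq : p ≠ q)
    (hfin : (N ∩ closedBall p s).Finite)
    (hMB : (fun y : ℂ => (δ : ℂ) * y) '' (N ∩ closedBall p s) ⊆ B)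
    (hball : closedBall ((δ : ℂ) * p) (4 * (δ * ℓ)) ⊆ B)
    (hvoid : ∀ w : ℂ, dist w p ≤ 2 * ℓ → ∃ y ∈ N, dist y w < ℓ / 2)
    (hvoid' : ∀ w : ℂ, dist w (transportMap f δ p) ≤ 2 * t' →
      ∃ y ∈ N, dist y p ≤ s ∧ dist (transportMap f δ y) w < t')
    (hfar' : ∀ y ∈ N, s < dist y p → 2 * t' < dist (transportMap f δ y) (transportMap f δ p))
    (hE₁ : IsDelaunayPair N p q)
    (hE₂ : ¬ IsDelaunayPair (transportMap f δ '' N) (transportMap f δ p) (transportMap f δ q)) :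
    NearTie N p ℓ ℓ (W * δ ^ 2 * ℓ ^ 3) ∨ ClosePair N p (3 * ℓ) (W * δ ^ 2 * ℓ ^ 3) := by
  set M : Set ℂ := N ∩ closedBall p s with hM
  set T : ℂ → ℂ := transportMap f δ with hT
  have hpM : p ∈ M := ⟨hp, mem_closedBall_self (by linarith)⟩
  -- the cell of `p` in `M` is small
  have hcell : voronoiCell M p ⊆ closedBall p ℓ := by
    refine voronoiCell_subset_closedBall_of_noVoid M (closedBall p ℓ) p ℓ hℓ Subset.rfl ?_
    intro z hz
    rw [mem_closedBall] at hz
    obtain ⟨y, hy, hyz⟩ := hvoid z (by linarith)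
    refine ⟨y, ⟨hy, ?_⟩, by rwa [dist_comm]⟩
    rw [mem_closedBall]
    linarith [dist_triangle y z p]
  -- `q ∈ M`: Delaunay partners are within twice the cell radius
  have hE₁M : IsDelaunayPair M p q := hE₁.anti inter_subset_left
  have hqp : dist q p ≤ 2 * ℓ := hE₁M.dist_le_two_mul hcell
  have hqM : q ∈ M := ⟨hq, by rw [mem_closedBall]; linarith⟩
  -- the defect survives localisation on the image side
  have hE₂M : ¬ IsDelaunayPair (T '' M) (T p) (T q) := by
    intro hloc
    refine hE₂ (isDelaunayPair_of_local (T '' M) (T '' N) (T p) (T q) t' ht'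
      (image_mono inter_subset_left) hloc (fun w hw => ?_) (fun y' hy' hy'M => ?_))
    · obtain ⟨y, hy, hys, hyw⟩ := hvoid' w hw
      exact ⟨T y, ⟨y, ⟨hy, mem_closedBall.2 hys⟩, rfl⟩, hyw⟩
    · obtain ⟨y, hy, rfl⟩ := hy'
      refine hfar' y hy (lt_of_not_ge fun hys => hy'M ⟨y, ⟨hy, mem_closedBall.2 hys⟩, rfl⟩)
  have hconcl := concl_of_defectPackage f B W ℓ₀ hD hδ hℓ hℓ₀ hfin hMB hpM hqM hpq hball hcell
    hE₁M hE₂M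
  have h := nearTie_or_closePair_of_concl hδ hpM hqM hpq hqp hτ hconcl
  rcases h with h | h
  · exact Or.inl (h.mono inter_subset_left (by rw [dist_self, add_zero]) le_rfl le_rfl)
  · exact Or.inr (h.mono inter_subset_left (by rw [dist_self, add_zero]) le_rfl)

/-- **Direction 2: pulled-back-adjacent but not Euclidean-adjacent.**  Same data, with the package
`hD'` for the INVERSE map `finv` on an image-side convex set `B'` (`finv (f (δ y)) = δ y` for the
sites within `s` of `p`), the images `T '' (N ∩ closedBall p s)` playing the role of the local
configuration: the transported pair is Delaunay among the transported local sites (fewer sites),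
its `finv`-transport — the original pair — is NOT Delaunay among the local sites by
`isDelaunayPair_of_local` on the domain side, the transported cell is small by the image-side
no-void hypothesis; Lemma 4.2 for `(finv, B')` then yields a near-tied navel or a close pair of the
TRANSPORTED local configuration near `T p`, tolerance `W' δ² ℓ'³`. -/
theorem potDef_of_pull_not_euc (f finv : ℂ → ℂ) (B' : Set ℂ) (W' ℓ₀' : ℝ)
    (hD' : ∀ (ω : Set ℂ) (p q : ℂ) (ℓ : ℝ), ω ⊆ B' → (∀ K : Set ℂ, IsCompact K → (ω ∩ K).Finite) →
      p ∈ ω → q ∈ ω → p ≠ q → 0 < ℓ → ℓ ≤ ℓ₀' → closedBall p (4 * ℓ) ⊆ B' →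
      voronoiCell ω p ⊆ closedBall p ℓ → IsDelaunayPair ω p q →
      ¬ IsDelaunayPair (finv '' ω) (finv p) (finv q) →
      (∃ (x a b : ℂ), a ∈ ω ∧ b ∈ ω ∧ a ≠ b ∧ a ≠ p ∧ a ≠ q ∧ b ≠ p ∧ b ≠ q ∧
        dist p x = dist q x ∧ dist p x ≤ ℓ ∧ (∀ d ∈ ω, dist p x ≤ dist d x) ∧
        dist a x = dist b x ∧ dist a x < dist p x + W' * ℓ ^ 3) ∨
      (∃ a ∈ ω, a ≠ p ∧ a ≠ q ∧ (dist a p < W' * ℓ ^ 3 ∨ dist a q < W' * ℓ ^ 3)))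
    {δ ℓ ℓ' s : ℝ} (hδ : 0 < δ) (hℓ : 0 < ℓ) (hℓ' : 0 < ℓ') (hℓs : 3 * ℓ ≤ s)
    (hℓ₀' : δ * ℓ' ≤ ℓ₀') (hτ' : W' * δ ^ 2 * ℓ' ^ 3 ≤ ℓ') {N : Set ℂ} {p q : ℂ} (hp : p ∈ N)
    (hq : q ∈ N) (hpq : p ≠ q) (hfin : (N ∩ closedBall p s).Finite)
    (hMB' : ∀ y ∈ N, dist y p ≤ s → f ((δ : ℂ) * y) ∈ B')
    (hleft : ∀ y ∈ N, dist y p ≤ s → finv (f ((δ : ℂ) * y)) = (δ : ℂ) * y)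
    (hball' : closedBall ((δ : ℂ) * transportMap f δ p) (4 * (δ * ℓ')) ⊆ B')
    (hvoid : ∀ w : ℂ, dist w p ≤ 2 * ℓ → ∃ y ∈ N, dist y w < ℓ / 2)
    (hvoid' : ∀ w : ℂ, dist w (transportMap f δ p) ≤ 2 * ℓ' →
      ∃ y ∈ N, dist y p ≤ s ∧ dist (transportMap f δ y) w < ℓ' / 2)
    (hqs : dist q p ≤ s)
    (hE₁ : ¬ IsDelaunayPair N p q)
    (hE₂ : IsDelaunayPair (transportMap f δ '' N) (transportMap f δ p) (transportMap f δ q)) :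
    NearTie (transportMap f δ '' (N ∩ closedBall p s)) (transportMap f δ p) ℓ' ℓ'
        (W' * δ ^ 2 * ℓ' ^ 3) ∨
      ClosePair (transportMap f δ '' (N ∩ closedBall p s)) (transportMap f δ p) (3 * ℓ')
        (W' * δ ^ 2 * ℓ' ^ 3) := by
  have hδ' : (δ : ℂ) ≠ 0 := Complex.ofReal_ne_zero.2 hδ.ne'
  set M : Set ℂ := N ∩ closedBall p s with hM
  set T : ℂ → ℂ := transportMap f δ with hT
  set M' : Set ℂ := T '' M with hM'def
  have hpM : p ∈ M := ⟨hp, mem_closedBall_self (by linarith)⟩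
  have hqM : q ∈ M := ⟨hq, mem_closedBall.2 hqs⟩
  -- `transportMap finv δ` undoes `T` on `M`
  have hTinv : ∀ y ∈ M, transportMap finv δ (T y) = y := by
    rintro y ⟨hy, hys⟩
    rw [hT, transportMap, transportMap, mul_div_cancel₀ _ hδ', hleft y hy (mem_closedBall.1 hys),
      mul_div_cancel_left₀ _ hδ']
  have hTinj : InjOn T M := fun y hy y' hy' h => by rw [← hTinv y hy, ← hTinv y' hy', h]
  -- the image-side cell is small
  have hcell' : voronoiCell M' (T p) ⊆ closedBall (T p) ℓ' := by
    refine voronoiCell_subset_closedBall_of_noVoid M' (closedBall (T p) ℓ') (T p) ℓ' hℓ'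
      Subset.rfl ?_
    intro z hz
    rw [mem_closedBall] at hz
    obtain ⟨y, hy, hys, hyz⟩ := hvoid' z (by linarith)
    exact ⟨T y, ⟨y, ⟨hy, mem_closedBall.2 hys⟩, rfl⟩, by rwa [dist_comm]⟩
  -- the transported pair is Delaunay among the transported local sites
  have hE₁' : IsDelaunayPair M' (T p) (T q) := hE₂.anti (image_mono inter_subset_left)
  -- and the original pair is not Delaunay among the local sites
  have hE₂' : ¬ IsDelaunayPair (transportMap finv δ '' M') (transportMap finv δ (T p))
      (transportMap finv δ (T q)) := by
    have hMM : transportMap finv δ '' M' = M := by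
      rw [hM'def, image_image]
      refine Subset.antisymm ?_ fun y hy => ⟨y, hy, hTinv y hy⟩
      rintro _ ⟨y, hy, rfl⟩
      show transportMap finv δ (T y) ∈ M
      rwa [hTinv y hy]
    rw [hMM, hTinv p hpM, hTinv q hqM]
    intro hloc
    refine hE₁ (isDelaunayPair_of_local M N p q ℓ hℓ inter_subset_left hloc (fun w hw => ?_)
      (fun y hy hyM => ?_))
    · obtain ⟨y, hy, hyw⟩ := hvoid w hw
      refine ⟨y, ⟨hy, mem_closedBall.2 ?_⟩, hyw.trans (by linarith)⟩
      have := dist_triangle y w p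
      linarith
    · have hys : s < dist y p := lt_of_not_ge fun h => hyM ⟨hy, mem_closedBall.2 h⟩
      linarith
  have hconcl := concl_of_defectPackage finv B' W' ℓ₀' hD' hδ hℓ' hℓ₀' (hfin.image T) ?_
    (mem_image_of_mem T hpM) (mem_image_of_mem T hqM) (fun h => hpq (hTinj hpM hqM h)) ?_ hcell'
    hE₁' hE₂'
  · have hqp' : dist (T q) (T p) ≤ 2 * ℓ' := hE₁'.dist_le_two_mul hcell'
    exact nearTie_or_closePair_of_concl hδ (mem_image_of_mem T hpM) (mem_image_of_mem T hqM)
      (fun h => hpq (hTinj hpM hqM h)) hqp' hτ' hconcl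
  · rintro _ ⟨_, ⟨y, ⟨hy, hys⟩, rfl⟩, rfl⟩
    show (δ : ℂ) * transportMap f δ y ∈ B'
    rw [← f_mul_eq hδ]
    exact hMB' y hy (mem_closedBall.1 hys)
  · rwa [hT, ← f_mul_eq hδ] at hball' ⊢

end Summit.CriticalPhenomena.CardyFormulaZ2.Cruxes.VoronoiHubFromSmirnov.MoebiusExactDelaunayDilationWard

end
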